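import Summits.KontsevichZagierPeriods.KontsevichZagierPeriods.Theorems.HurwitzMicroSectorsNormalFormPrincipleM4SimplexFacts

/-!
# `NormalFormPrinciple` (stmt-KontsevichZagierPeriods-3869), line `SketchIdeator1` —
# leaf `stub_boxRigidity`, layer `M4` toolkit: the reflection (duality) move in dimension four

Pure proof file (registered sub-goal `m4_reflection_move4` of stmt-KontsevichZagierPeriods-3869,
line `SketchIdeator1`, lead seat c9; layer `M4` toolkit of the dimension-four campaign of the leaf
`stub_boxRigidity`; `--supports` the crux). On the decreasing open simplex
`Δ₄ = {0 < t₃ < t₂ < t₁ < t₀ < 1} ⊆ ℝ⁴` a *word representation* is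
`[Δ₄, x(t₀) y(t₁) z(t₂) w(t₃)]` for letters `x, y, z, w : ℝ → ℝ` (the iterated integral
`∫ x y z w` over `1 > t₀ > t₁ > t₂ > t₃ > 0`). The REFLECTION `t ↦ 1 − t` on all four coordinates
with order reversal, i.e. the affine involution `ι(t) = (1 − t₃, 1 − t₂, 1 − t₁, 1 − t₀)` of `Δ₄`
(a `ℚ`-polynomial map with constant derivative — the matrix `(diagonal (−1)).submatrix rev id` —
of absolute determinant `1`; `ι ∘ ι = id`, so `ι` is injective on `Δ₄` and `ι '' Δ₄ = Δ₄`),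
carries the word `x y z w` to the word `w̄ z̄ ȳ x̄` with `f̄(u) = f(1 − u)` (MZV duality in
weight four). This file proves, for an ARBITRARY word integrand of a GIVEN representation `T`
on `Δ₄`:

1. `[N] − [T] ∈ KZ.relations` for every representation `N` on `Δ₄` whose integrand agrees with
   `w(1 − t₀) z(1 − t₁) y(1 − t₂) x(1 − t₃)` on `Δ₄`, as ONE change of variables (rule (2),
   `KZ.changeOfVariablesRel`) along `ι`: the pull-back identity
   `N.integrand t = T.integrand (ι t) · |det Dι|` on `Δ₄` reads
   `w(1 − t₀) z(1 − t₁) y(1 − t₂) x(1 − t₃) = x(1 − t₃) y(1 − t₂) z(1 − t₁) w(1 − t₀) · 1`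
   (`m4r_reflection_rel`);
2. the EXISTENCE of such an `N` (`m4r_exists_reflected`): its integrand is `ℚ`-semialgebraic on
   `Δ₄` as the composite of `T.integrand` with the `ℚ`-semialgebraic chart `ι : Δ₄ → Δ₄`
   (`IsSemialgebraicFunOn.comp_isSemialgebraicMapOn_holds`, then congruence on `Δ₄`), and
   absolutely integrable on `Δ₄` by the Jacobian-`1` change of variables
   (`MeasureTheory.integrableOn_image_iff_integrableOn_abs_det_fderiv_smul` with `ι '' Δ₄ = Δ₄`).

Nothing about `x, y, z, w` is assumed beyond what `T` provides.

Sources: M. Kontsevich, D. Zagier, *Periods* (2001), §1.1–1.2, rule (2). No definitions are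
introduced.
-/

noncomputable section

open MeasureTheory Set
open Literature.NumberTheory.Transcendental Literature.NumberTheory.Transcendental.KZ
open Literature.ModelTheory.ExponentialFields (IsSemialgebraic)

namespace Summit.KontsevichZagierPeriods.HurwitzMicroSectors.NormalFormPrinciple.PiBox.M3

/-! ## The affine involution `ι(t) = (1 − t₃, 1 − t₂, 1 − t₁, 1 − t₀)` -/

/-- **The duality chart of dimension four.** The affine involution
`ι(t) = (1 − t₃, 1 − t₂, 1 − t₁, 1 − t₀)` of `ℝ⁴`, i.e. `ι(t)_j = 1 − t_{rev j}`: its components,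
`ℚ`-semialgebraicity on every `ℚ`-semialgebraic set (it is a `ℚ`-polynomial map),
differentiability with the constant derivative given by the matrix
`(diagonal (−1)).submatrix rev id`, `ι ∘ ι = id`, and `|det Dι| = 1`. [folklore] -/
theorem m4r_exists_dualityChart :
    ∃ (Φ : (Fin 4 → ℝ) → (Fin 4 → ℝ)) (Φ' : (Fin 4 → ℝ) → (Fin 4 → ℝ) →L[ℝ] (Fin 4 → ℝ)),
      (∀ t, Φ t 0 = 1 - t 3) ∧ (∀ t, Φ t 1 = 1 - t 2) ∧ (∀ t, Φ t 2 = 1 - t 1) ∧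
      (∀ t, Φ t 3 = 1 - t 0) ∧
      (∀ σ : Set (Fin 4 → ℝ), IsSemialgebraic ℚ σ → IsSemialgebraicMapOn ℚ σ Φ) ∧
      (∀ t, HasFDerivAt Φ (Φ' t) t) ∧ (∀ t, Φ (Φ t) = t) ∧ (∀ t, |(Φ' t).det| = 1) := by
  set A : (Fin 4 → ℝ) →L[ℝ] (Fin 4 → ℝ) :=
    LinearMap.toContinuousLinearMap (Matrix.toLin'
      ((Matrix.diagonal fun _ : Fin 4 => (-1 : ℝ)).submatrix (Fin.revPerm : Fin 4 ≃ Fin 4)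
        (Equiv.refl (Fin 4))))
  set Φ : (Fin 4 → ℝ) → (Fin 4 → ℝ) := fun t => (fun _ => (1:ℝ)) + A t
  have hAv : ∀ (v : Fin 4 → ℝ) (j : Fin 4), A v j = -v (Fin.rev j) := by
    intro v j
    change Matrix.toLin' ((Matrix.diagonal fun _ : Fin 4 => (-1 : ℝ)).submatrix
      (Fin.revPerm : Fin 4 ≃ Fin 4) (Equiv.refl (Fin 4))) v j = _
    rw [Matrix.toLin'_apply, Matrix.submatrix_mulVec_equiv]
    simp
  have hΦj : ∀ (t : Fin 4 → ℝ) (j : Fin 4), Φ t j = 1 - t (Fin.rev j) := fun t j => by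
    show 1 + A t j = 1 - t (Fin.rev j)
    rw [hAv, sub_eq_add_neg]
  refine ⟨Φ, fun _ => A, fun t => hΦj t 0, fun t => hΦj t 1, fun t => hΦj t 2, fun t => hΦj t 3,
    fun σ hσ => ?_, fun t => A.hasFDerivAt.const_add (fun _ : Fin 4 => (1:ℝ)), fun t => ?_,
    fun t => ?_⟩
  · -- a `ℚ`-polynomial map is `ℚ`-semialgebraic
    refine (isSemialgebraicMapOn_aeval hσ fun j =>
      (1 - MvPolynomial.X (Fin.rev j) : MvPolynomial (Fin 4) ℚ)).congr fun t _ => ?_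
    funext j
    simp [hΦj]
  · -- involution
    funext j
    simp [hΦj, Fin.rev_rev]
  · -- the Jacobian determinant, up to sign
    change |LinearMap.det (Matrix.toLin' ((Matrix.diagonal fun _ : Fin 4 => (-1 : ℝ)).submatrix
      (Fin.revPerm : Fin 4 ≃ Fin 4) (Equiv.refl (Fin 4))))| = 1
    rw [LinearMap.det_toLin', Matrix.abs_det_submatrix_equiv_equiv, Matrix.det_diagonal,
      Finset.abs_prod]
    simp only [abs_neg, abs_one, Finset.prod_const_one]

/-! ## The reflection preserves the decreasing open simplex `Δ₄` -/

/-- A map with components `(1 − t₃, 1 − t₂, 1 − t₁, 1 − t₀)` sends the decreasing open simplex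
`Δ₄ = {0 < t₃ < t₂ < t₁ < t₀ < 1}` into itself. [folklore] -/
theorem m4r_mapsTo_simplex4 {Φ : (Fin 4 → ℝ) → (Fin 4 → ℝ)}
    (hΦ0 : ∀ t, Φ t 0 = 1 - t 3) (hΦ1 : ∀ t, Φ t 1 = 1 - t 2) (hΦ2 : ∀ t, Φ t 2 = 1 - t 1)
    (hΦ3 : ∀ t, Φ t 3 = 1 - t 0) {D : Set (Fin 4 → ℝ)}
    (hD : D = {t | 0 < t 3 ∧ t 3 < t 2 ∧ t 2 < t 1 ∧ t 1 < t 0 ∧ t 0 < 1}) :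
    MapsTo Φ D D := by
  intro t ht
  rw [hD] at ht ⊢
  obtain ⟨h3, h32, h21, h10, h0⟩ := ht
  simp only [mem_setOf_eq, hΦ0, hΦ1, hΦ2, hΦ3]
  exact ⟨by linarith, by linarith, by linarith, by linarith, by linarith⟩

/-- An involution of `ℝ⁴` mapping a set `D` into itself maps `D` onto itself and is injective on
`D`. [folklore] -/
theorem m4r_image_eq_and_injOn {Φ : (Fin 4 → ℝ) → (Fin 4 → ℝ)} (hinv : ∀ t, Φ (Φ t) = t)
    {D : Set (Fin 4 → ℝ)} (hmaps : MapsTo Φ D D) : Φ '' D = D ∧ InjOn Φ D := by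
  refine ⟨Subset.antisymm ?_ fun v hv => ⟨Φ v, hmaps hv, hinv v⟩, fun u _ v _ huv =>
    (hinv u).symm.trans (by rw [huv]; exact hinv v)⟩
  rintro _ ⟨t, ht, rfl⟩
  exact hmaps ht

/-! ## Part 1: the reflection as ONE rule-(2) move -/

/-- **The reflection move on word integrands of dimension four.** Let `T` be a representation on
the decreasing open simplex `Δ₄` whose integrand agrees with the word `x(t₀) y(t₁) z(t₂) w(t₃)`
on `Δ₄`, and let `N` be any representation on `Δ₄` whose integrand agrees with the reflected
word `w(1 − t₀) z(1 − t₁) y(1 − t₂) x(1 − t₃)` on `Δ₄`. Then `[N] − [T]` is ONE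
change-of-variables move of the Kontsevich–Zagier calculus along the affine involution
`ι(t) = (1 − t₃, 1 − t₂, 1 − t₁, 1 − t₀)` of `Δ₄` (`m4r_exists_dualityChart`, `|det Dι| = 1`):
the pull-back identity `N.integrand t = T.integrand (ι t) · |det Dι|` on `Δ₄` is
`w(1 − t₀) z(1 − t₁) y(1 − t₂) x(1 − t₃) = x(1 − t₃) y(1 − t₂) z(1 − t₁) w(1 − t₀) · 1`.
[cite: KontsevichZagier2001, §1.2 rule (2)] -/
theorem m4r_reflection_rel (x y z w : ℝ → ℝ) (T : IntegralRep 4)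
    (hTd : T.domain = {t | 0 < t 3 ∧ t 3 < t 2 ∧ t 2 < t 1 ∧ t 1 < t 0 ∧ t 0 < 1})
    (hTi : EqOn T.integrand (fun t => x (t 0) * y (t 1) * z (t 2) * w (t 3)) T.domain)
    (N : IntegralRep 4)
    (hNd : N.domain = {t | 0 < t 3 ∧ t 3 < t 2 ∧ t 2 < t 1 ∧ t 1 < t 0 ∧ t 0 < 1})
    (hNi : EqOn N.integrand (fun t => w (1 - t 0) * z (1 - t 1) * y (1 - t 2) * x (1 - t 3))
      N.domain) :
    of N - of T ∈ relations := by
  obtain ⟨Φ, Φ', hΦ0, hΦ1, hΦ2, hΦ3, hsa, hderiv, hinv, hdet⟩ := m4r_exists_dualityChart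
  -- `ι` maps `Δ₄` into `Δ₄`, hence (being an involution) onto `Δ₄`, injectively
  have hmaps : MapsTo Φ N.domain N.domain := m4r_mapsTo_simplex4 hΦ0 hΦ1 hΦ2 hΦ3 hNd
  obtain ⟨hfix, hinj⟩ := m4r_image_eq_and_injOn hinv hmaps
  have himage : T.domain = Φ '' N.domain := by rw [hfix, hTd, hNd]
  refine changeOfVariablesRel_subset_relations
    ⟨4, N, T, Φ, Φ', hsa _ N.isSemialgebraic_domain, fun t _ => (hderiv t).hasFDerivWithinAt,
      hinj, himage, fun t ht => ?_, rfl⟩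
  -- the pull-back identity on `Δ₄`, Jacobian `|det Dι| = 1` included
  have hΦt : Φ t ∈ T.domain := himage ▸ mem_image_of_mem _ ht
  rw [hNi ht, hTi hΦt, hdet t, mul_one]
  simp only [hΦ0, hΦ1, hΦ2, hΦ3]
  ring

/-! ## Part 2: the reflected word carrier exists -/

/-- **The reflected word representation exists.** Let `T` be a representation on the decreasing
open simplex `Δ₄` whose integrand agrees with the word `x(t₀) y(t₁) z(t₂) w(t₃)` on `Δ₄`. Then
`[Δ₄, w(1 − t₀) z(1 − t₁) y(1 − t₂) x(1 − t₃)]` is an integral representation of the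
Kontsevich–Zagier calculus: on `Δ₄` its integrand is `T.integrand ∘ ι` for the affine involution
`ι(t) = (1 − t₃, 1 − t₂, 1 − t₁, 1 − t₀)` of `Δ₄` (`m4r_exists_dualityChart`), hence
`ℚ`-semialgebraic on `Δ₄` (composite of a semialgebraic function with a semialgebraic map,
Tarski–Seidenberg), and it is absolutely integrable on `Δ₄ = ι '' Δ₄` by the change-of-variables
formula with Jacobian `|det Dι| = 1`. [cite: KontsevichZagier2001, §1.1–1.2 rule (2)] -/
theorem m4r_exists_reflected (x y z w : ℝ → ℝ) (T : IntegralRep 4)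
    (hTd : T.domain = {t | 0 < t 3 ∧ t 3 < t 2 ∧ t 2 < t 1 ∧ t 1 < t 0 ∧ t 0 < 1})
    (hTi : EqOn T.integrand (fun t => x (t 0) * y (t 1) * z (t 2) * w (t 3)) T.domain) :
    ∃ N : IntegralRep 4, N.domain = {t | 0 < t 3 ∧ t 3 < t 2 ∧ t 2 < t 1 ∧ t 1 < t 0 ∧ t 0 < 1} ∧
      N.integrand = fun t => w (1 - t 0) * z (1 - t 1) * y (1 - t 2) * x (1 - t 3) := by
  obtain ⟨Φ, Φ', hΦ0, hΦ1, hΦ2, hΦ3, hsa, hderiv, hinv, hdet⟩ := m4r_exists_dualityChart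
  have hmaps : MapsTo Φ T.domain T.domain := m4r_mapsTo_simplex4 hΦ0 hΦ1 hΦ2 hΦ3 hTd
  obtain ⟨hfix, hinj⟩ := m4r_image_eq_and_injOn hinv hmaps
  -- on `Δ₄`, `T.integrand ∘ ι` is the reflected word
  have hpt : ∀ t ∈ T.domain,
      T.integrand (Φ t) = w (1 - t 0) * z (1 - t 1) * y (1 - t 2) * x (1 - t 3) := by
    intro t ht
    rw [hTi (hmaps ht)]
    simp only [hΦ0, hΦ1, hΦ2, hΦ3]
    ring
  -- semialgebraicity by composition with the chart
  have hsa' : IsSemialgebraicFunOn ℚ T.domain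
      (fun t => w (1 - t 0) * z (1 - t 1) * y (1 - t 2) * x (1 - t 3)) :=
    (IsSemialgebraicFunOn.comp_isSemialgebraicMapOn_holds T.isSemialgebraicFunOn_integrand
      (hsa _ T.isSemialgebraic_domain) hmaps).congr fun t ht => hpt t ht
  -- integrability transported along the Jacobian-`1` chart `ι : Δ₄ → Δ₄ = ι '' Δ₄`
  have hDm : MeasurableSet T.domain := IntegralRep.measurableSet_domain_holds T
  have hint : IntegrableOn (fun t => w (1 - t 0) * z (1 - t 1) * y (1 - t 2) * x (1 - t 3))
      T.domain := by
    have h0 : IntegrableOn T.integrand (Φ '' T.domain) := by rw [hfix]; exact T.integrableOn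
    have h := (integrableOn_image_iff_integrableOn_abs_det_fderiv_smul volume hDm
      (fun t _ => (hderiv t).hasFDerivWithinAt) hinj T.integrand).mp h0
    refine h.congr_fun (fun t ht => ?_) hDm
    show |(Φ' t).det| • T.integrand (Φ t) = w (1 - t 0) * z (1 - t 1) * y (1 - t 2) * x (1 - t 3)
    rw [hdet t, one_smul, hpt t ht]
  exact ⟨⟨T.domain, _, T.isSemialgebraic_domain, hsa', hint⟩, hTd, rfl⟩

/-! ## The registered sub-goal -/

/-- **Stub `m4_reflection_move4` (registered sub-goal of stmt-KontsevichZagierPeriods-3869, line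
`SketchIdeator1`, layer `M4` toolkit).** On the decreasing open simplex
`Δ₄ = {0 < t₃ < t₂ < t₁ < t₀ < 1} ⊆ ℝ⁴`, for arbitrary letters `x, y, z, w : ℝ → ℝ` and a given
representation `T = [Δ₄, x(t₀) y(t₁) z(t₂) w(t₃)]` (integrand up to agreement on `Δ₄`): (1) every
representation `N = [Δ₄, w(1 − t₀) z(1 − t₁) y(1 − t₂) x(1 − t₃)]` (integrand up to agreement on
`Δ₄`) satisfies `[N] − [T] ∈ KZ.relations`, by ONE change of variables along the reflection
`t ↦ (1 − t₃, 1 − t₂, 1 − t₁, 1 − t₀)` of `Δ₄` onto itself, `|det| = 1` (`m4r_reflection_rel`);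
(2) such an `N` exists (`m4r_exists_reflected`). [cite: KontsevichZagier2001, §1.2 rule (2)] -/
theorem m4_reflection_move4 :
    ∀ (x y z w : ℝ → ℝ) (T : IntegralRep 4),
      T.domain = {t | 0 < t 3 ∧ t 3 < t 2 ∧ t 2 < t 1 ∧ t 1 < t 0 ∧ t 0 < 1} →
      EqOn T.integrand (fun t => x (t 0) * y (t 1) * z (t 2) * w (t 3)) T.domain →
      (∀ N : IntegralRep 4, N.domain = {t | 0 < t 3 ∧ t 3 < t 2 ∧ t 2 < t 1 ∧ t 1 < t 0 ∧ t 0 < 1} →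
        EqOn N.integrand (fun t => w (1 - t 0) * z (1 - t 1) * y (1 - t 2) * x (1 - t 3)) N.domain →
        of N - of T ∈ relations) ∧
      (∃ N : IntegralRep 4, N.domain = {t | 0 < t 3 ∧ t 3 < t 2 ∧ t 2 < t 1 ∧ t 1 < t 0 ∧ t 0 < 1} ∧
        N.integrand = fun t => w (1 - t 0) * z (1 - t 1) * y (1 - t 2) * x (1 - t 3)) := by
  intro x y z w T hTd hTi
  exact ⟨m4r_reflection_rel x y z w T hTd hTi, m4r_exists_reflected x y z w T hTd hTi⟩

end Summit.KontsevichZagierPeriods.HurwitzMicroSectors.NormalFormPrinciple.PiBox.M3
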